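import Literature.Analysis.ODE.SuperradiantPairing
import Literature.Analysis.ODE.BarrierDominance
import Literature.Analysis.ODE.BarrierBasis
import HarnessLib

/-!
# Two-point Green-kernel bound across a single DEEP barrier for two flux-carrying solutions
# without a sign condition on the fluxes (superradiant regime)

Topic `Literature/Analysis/ODE` (namespace `Literature.Analysis.ODE`). The superradiant companion of
`KernelTwoPointBound.kernel_le_of_envelopes_barrier`. Let `u, v` be complex solutions on `ℝ` of the
real equation `y″ = −φ y` with constant fluxes `Im(ū u′) ≡ −σ`, `Im(v̄ v′) ≡ ω`, `σ ≠ 0`, `ω ≠ 0`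
(ANY signs: at a superradiant frequency `ωσ < 0` and the flux pairing is void), let `[α, β]` be a
barrier (`φ` continuous, `φ ≤ 0` on `[α, β]`), and suppose:
* ENVELOPES outside: `‖u s‖ ≤ P_u` for `s ≤ α`, `‖v s‖ ≤ P_v` for `s ≥ β`, and end data
  `‖u′(α)‖ ≤ P₁`, `‖v′(β)‖ ≤ Q₁`;
* DEPTH and RATES of the barrier, stated for the monotone two-end real basis `g, d` of `y″ = −φ y`
  on `[α, β]` (`g(α) = 1, g′(α) = 0`, `d(β) = 1, d′(β) = 0`, `w₀ = g′(β)`; it exists by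
  `exists_barrierBasis` and the hypothesis is quantified over all such bases, so that the user
  certifies it by comparison arguments): `2P₁²Q₁² ≤ |σ||ω| w₀²` (depth), `d(α) ≤ R_α w₀`,
  `g(β) ≤ R_β w₀` (reciprocal end rates) and `g(x)d(x) ≤ R_m w₀` for the points `x ∈ [α, β]` beyond
  a mark `x₀` (reciprocal interior rate; only needed at the second point of the pair).
Then for all `x ≤ x′` with `x₀ ≤ x′`:

  `‖u x‖ · ‖v x′‖ ≤ K · ‖u v′ − v u′‖`,
  `K = 3P_u²/|σ| + 3P_v²/|ω| + 2P_uP_v/s + P_u(2Q₁R_β/s + 2P₁R_α/|σ|) + P_v(2Q₁R_β/|ω| + 2P₁R_α/s)`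
   `+ (2Q₁²R_β²/|ω| + 2R_m + 2P₁Q₁R_αR_β/s + 2P₁²R_α²/|σ|)`,  `s = √(|ω||σ|)`

(`kernel_le_of_deep_barrier`). The six summands are the six position cases: both points before the
barrier / both after (sign-free pairing with the Wronskian floor, `SuperradiantPairing.lean`),
straddling, one point inside, both inside (`BarrierDominance.lean`: dominance of the growing
components, `‖W‖ ≥ |σ||ω| w₀/(2P₁Q₁)`, and the two-point bounds over the basis); depth converts every
residual `P₁Q₁/w₀` into `≤ s` (`mul_div_le_sqrt_of_depth`) and makes `1 + s/W₀ ≤ 3`. The scalar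
conversions are isolated as `deepBarrier_coeff_*`.

No asymptotic analysis enters and nothing is specific to an equation. Used for the cone Green-kernel
bound of Carter's radial equation in the Breitenlohner–Freedman-stable superradiant sectors of the
near-extremal Kerr programme, where the envelopes come from the horizon/far zones and depth/rates
from the throat geometry (not here).

## References
* P. Hartman, *Ordinary Differential Equations* (SIAM Classics 38, 2002), Ch. XI §§2, 6. Key
  `Hartman2002`.
* I. M. Gelfand, L. A. Dikii, Russian Math. Surveys 30:5 (1975) (diagonal resolvent kernel `ψ₊ψ₋/W`).
  The assembly is folklore.
-/

noncomputable section

open Set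
open scoped ComplexConjugate

namespace Literature.Analysis.ODE

/-! ### Scalar consequences of depth -/

/-- Depth `2P₁²Q₁² ≤ |σ||ω|w₀²` with `w₀ > 0` gives `P₁Q₁/w₀ ≤ √(|ω||σ|)`. [folklore] -/
theorem mul_div_le_sqrt_of_depth {P₁ Q₁ w₀ σ ω : ℝ} (hw₀ : 0 < w₀)
    (hdeep : 2 * P₁ ^ 2 * Q₁ ^ 2 ≤ |σ| * |ω| * w₀ ^ 2) :
    P₁ * Q₁ / w₀ ≤ Real.sqrt (|ω| * |σ|) := by
  set s := Real.sqrt (|ω| * |σ|) with hs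
  have hs0 : 0 ≤ s := Real.sqrt_nonneg _
  have hs2 : s ^ 2 = |ω| * |σ| := Real.sq_sqrt (by positivity)
  rw [div_le_iff₀ hw₀]
  have h1 : (P₁ * Q₁) ^ 2 ≤ (s * w₀) ^ 2 := by
    calc (P₁ * Q₁) ^ 2 ≤ 2 * P₁ ^ 2 * Q₁ ^ 2 := by nlinarith [sq_nonneg (P₁ * Q₁)]
      _ ≤ |σ| * |ω| * w₀ ^ 2 := hdeep
      _ = (s * w₀) ^ 2 := by rw [mul_pow, hs2]; ring
  exact le_of_pow_le_pow_left₀ two_ne_zero (mul_nonneg hs0 hw₀.le) h1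

/-- With `s = √(|ω||σ|) > 0`, `W₀ = |σ||ω|w₀/(2P₁Q₁)` and `P₁Q₁/w₀ ≤ s`: `1 + s/W₀ ≤ 3`. [folklore] -/
theorem one_add_sqrt_div_floor_le_three {P₁ Q₁ w₀ σ ω : ℝ} (hw₀ : 0 < w₀) (hP₁ : 0 < P₁)
    (hQ₁ : 0 < Q₁) (hσ : σ ≠ 0) (hω : ω ≠ 0)
    (hle : P₁ * Q₁ / w₀ ≤ Real.sqrt (|ω| * |σ|)) :
    1 + Real.sqrt (|ω| * |σ|) / (|σ| * |ω| * w₀ / (2 * P₁ * Q₁)) ≤ 3 := by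
  set s := Real.sqrt (|ω| * |σ|) with hs
  have hσ' : 0 < |σ| := abs_pos.2 hσ
  have hω' : 0 < |ω| := abs_pos.2 hω
  have hPQ : 0 < 2 * P₁ * Q₁ := by have := mul_pos hP₁ hQ₁; linarith
  have hs2 : s ^ 2 = |ω| * |σ| := Real.sq_sqrt (by positivity)
  have hW₀ : 0 < |σ| * |ω| * w₀ / (2 * P₁ * Q₁) :=
    div_pos (mul_pos (mul_pos hσ' hω') hw₀) hPQ
  have key : s / (|σ| * |ω| * w₀ / (2 * P₁ * Q₁)) ≤ 2 := by
    rw [div_le_iff₀ hW₀]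
    have h1 : P₁ * Q₁ ≤ s * w₀ := by rwa [div_le_iff₀ hw₀] at hle
    have h2 : s * (2 * P₁ * Q₁) ≤ 2 * (|σ| * |ω| * w₀) := by
      calc s * (2 * P₁ * Q₁) = 2 * (s * (P₁ * Q₁)) := by ring
        _ ≤ 2 * (s * (s * w₀)) := by gcongr
        _ = 2 * (s ^ 2 * w₀) := by ring
        _ = 2 * (|σ| * |ω| * w₀) := by rw [hs2]; ring
    calc s = s * (2 * P₁ * Q₁) / (2 * P₁ * Q₁) := by field_simp
      _ ≤ 2 * (|σ| * |ω| * w₀) / (2 * P₁ * Q₁) := div_le_div_of_nonneg_right h2 hPQ.le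
      _ = 2 * (|σ| * |ω| * w₀ / (2 * P₁ * Q₁)) := by ring
  linarith

section Coefficients

/-! ### The coefficient conversions (`a = |σ|`, `b = |ω|`, `s² = a b`, `P₁Q₁/w₀ ≤ s`) -/

variable {a b s w₀ P₁ Q₁ Rα Rβ : ℝ}

/-- Straddling pairs: `2P₁Q₁/(a b w₀) ≤ 2/s`. [folklore] -/
theorem deepBarrier_coeff_straddle (ha : 0 < a) (hb : 0 < b) (hs : 0 < s) (hs2 : s ^ 2 = b * a)
    (hw₀ : 0 < w₀) (hdep : P₁ * Q₁ / w₀ ≤ s) :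
    2 * P₁ * Q₁ / (a * b * w₀) ≤ 2 / s := by
  have hab : a * b = s * s := by rw [← sq, hs2, mul_comm]
  calc 2 * P₁ * Q₁ / (a * b * w₀) = (2 / (a * b)) * (P₁ * Q₁ / w₀) := by field_simp
    _ ≤ (2 / (a * b)) * s := mul_le_mul_of_nonneg_left hdep (by positivity)
    _ = 2 / s := by rw [hab]; field_simp

/-- Cap × barrier pairs: `2P₁Q₁²g/(a b w₀²) + 2P₁d/(a w₀) ≤ 2Q₁R_β/s + 2P₁R_α/a` when `g ≤ R_β w₀`,
`d ≤ R_α w₀`. [folklore] -/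
theorem deepBarrier_coeff_left (ha : 0 < a) (hb : 0 < b) (hs : 0 < s) (hs2 : s ^ 2 = b * a)
    (hw₀ : 0 < w₀) (hP₁ : 0 ≤ P₁) (hQ₁ : 0 ≤ Q₁) (hRβ : 0 ≤ Rβ) (hdep : P₁ * Q₁ / w₀ ≤ s)
    {g d : ℝ} (hg : g ≤ Rβ * w₀) (hd : d ≤ Rα * w₀) :
    2 * P₁ * Q₁ ^ 2 * g / (a * b * w₀ ^ 2) + 2 * P₁ * d / (a * w₀) ≤
      2 * Q₁ * Rβ / s + 2 * P₁ * Rα / a := by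
  have hab : a * b = s * s := by rw [← sq, hs2, mul_comm]
  have t1 : 2 * P₁ * Q₁ ^ 2 * g / (a * b * w₀ ^ 2) ≤ 2 * Q₁ * Rβ / s := by
    calc 2 * P₁ * Q₁ ^ 2 * g / (a * b * w₀ ^ 2)
        ≤ 2 * P₁ * Q₁ ^ 2 * (Rβ * w₀) / (a * b * w₀ ^ 2) := by gcongr
      _ = (2 * Q₁ * Rβ / (a * b)) * (P₁ * Q₁ / w₀) := by field_simp
      _ ≤ (2 * Q₁ * Rβ / (a * b)) * s := mul_le_mul_of_nonneg_left hdep (by positivity)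
      _ = 2 * Q₁ * Rβ / s := by rw [hab]; field_simp
  have t2 : 2 * P₁ * d / (a * w₀) ≤ 2 * P₁ * Rα / a := by
    calc 2 * P₁ * d / (a * w₀) ≤ 2 * P₁ * (Rα * w₀) / (a * w₀) := by gcongr
      _ = 2 * P₁ * Rα / a := by field_simp
  linarith

/-- Barrier × far pairs: `2Q₁g/(b w₀) + 2P₁²Q₁d/(a b w₀²) ≤ 2Q₁R_β/b + 2P₁R_α/s` when `g ≤ R_β w₀`,
`d ≤ R_α w₀`. [folklore] -/
theorem deepBarrier_coeff_right (ha : 0 < a) (hb : 0 < b) (hs : 0 < s) (hs2 : s ^ 2 = b * a)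
    (hw₀ : 0 < w₀) (hP₁ : 0 ≤ P₁) (hQ₁ : 0 ≤ Q₁) (hRα : 0 ≤ Rα) (hdep : P₁ * Q₁ / w₀ ≤ s)
    {g d : ℝ} (hg : g ≤ Rβ * w₀) (hd : d ≤ Rα * w₀) :
    2 * Q₁ * g / (b * w₀) + 2 * P₁ ^ 2 * Q₁ * d / (a * b * w₀ ^ 2) ≤
      2 * Q₁ * Rβ / b + 2 * P₁ * Rα / s := by
  have hab : a * b = s * s := by rw [← sq, hs2, mul_comm]
  have t1 : 2 * Q₁ * g / (b * w₀) ≤ 2 * Q₁ * Rβ / b := by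
    calc 2 * Q₁ * g / (b * w₀) ≤ 2 * Q₁ * (Rβ * w₀) / (b * w₀) := by gcongr
      _ = 2 * Q₁ * Rβ / b := by field_simp
  have t2 : 2 * P₁ ^ 2 * Q₁ * d / (a * b * w₀ ^ 2) ≤ 2 * P₁ * Rα / s := by
    calc 2 * P₁ ^ 2 * Q₁ * d / (a * b * w₀ ^ 2)
        ≤ 2 * P₁ ^ 2 * Q₁ * (Rα * w₀) / (a * b * w₀ ^ 2) := by gcongr
      _ = (2 * P₁ * Rα / (a * b)) * (P₁ * Q₁ / w₀) := by field_simp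
      _ ≤ (2 * P₁ * Rα / (a * b)) * s := mul_le_mul_of_nonneg_left hdep (by positivity)
      _ = 2 * P₁ * Rα / s := by rw [hab]; field_simp
  linarith

/-- Barrier × barrier pairs: the four terms of `barrier_two_point_of_dominance` (1) are at most
`2Q₁²R_β²/b + 2R_m + 2P₁Q₁R_αR_β/s + 2P₁²R_α²/a` when `0 ≤ g ≤ R_β w₀` (value at the second point),
`0 ≤ d ≤ R_α w₀` (value at the first point), `gd ≤ R_m w₀`, `dα ≤ R_α w₀`, `0 ≤ gβ ≤ R_β w₀`.
[folklore] -/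
theorem deepBarrier_coeff_inside (ha : 0 < a) (hb : 0 < b) (hs : 0 < s) (hs2 : s ^ 2 = b * a)
    (hw₀ : 0 < w₀) (hP₁ : 0 ≤ P₁) (hQ₁ : 0 ≤ Q₁) (hRα : 0 ≤ Rα) (hRβ : 0 ≤ Rβ)
    (hdep : P₁ * Q₁ / w₀ ≤ s) {g d gd dα gβ Rm : ℝ} (hg0 : 0 ≤ g) (hg : g ≤ Rβ * w₀) (hd0 : 0 ≤ d)
    (hd : d ≤ Rα * w₀) (hgd : gd ≤ Rm * w₀) (hdα : dα ≤ Rα * w₀) (hgβ0 : 0 ≤ gβ)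
    (hgβ : gβ ≤ Rβ * w₀) :
    2 * Q₁ ^ 2 * g ^ 2 / (b * w₀ ^ 2) + 2 * gd / w₀ + 2 * P₁ ^ 2 * Q₁ ^ 2 * (dα * gβ) / (a * b * w₀ ^ 3) +
        2 * P₁ ^ 2 * d ^ 2 / (a * w₀ ^ 2) ≤
      2 * Q₁ ^ 2 * Rβ ^ 2 / b + 2 * Rm + 2 * P₁ * Q₁ * (Rα * Rβ) / s + 2 * P₁ ^ 2 * Rα ^ 2 / a := by
  have hab : a * b = s * s := by rw [← sq, hs2, mul_comm]
  have t1 : 2 * Q₁ ^ 2 * g ^ 2 / (b * w₀ ^ 2) ≤ 2 * Q₁ ^ 2 * Rβ ^ 2 / b := by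
    have : g ^ 2 ≤ (Rβ * w₀) ^ 2 := pow_le_pow_left₀ hg0 hg 2
    calc 2 * Q₁ ^ 2 * g ^ 2 / (b * w₀ ^ 2) ≤ 2 * Q₁ ^ 2 * (Rβ * w₀) ^ 2 / (b * w₀ ^ 2) := by gcongr
      _ = 2 * Q₁ ^ 2 * Rβ ^ 2 / b := by field_simp
  have t2 : 2 * gd / w₀ ≤ 2 * Rm := by
    rw [div_le_iff₀ hw₀]; linarith
  have t3 : 2 * P₁ ^ 2 * Q₁ ^ 2 * (dα * gβ) / (a * b * w₀ ^ 3) ≤ 2 * P₁ * Q₁ * (Rα * Rβ) / s := by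
    have hdg : dα * gβ ≤ (Rα * w₀) * (Rβ * w₀) := mul_le_mul hdα hgβ hgβ0 (by positivity)
    calc 2 * P₁ ^ 2 * Q₁ ^ 2 * (dα * gβ) / (a * b * w₀ ^ 3)
        ≤ 2 * P₁ ^ 2 * Q₁ ^ 2 * ((Rα * w₀) * (Rβ * w₀)) / (a * b * w₀ ^ 3) := by gcongr
      _ = (2 * P₁ * Q₁ * (Rα * Rβ) / (a * b)) * (P₁ * Q₁ / w₀) := by field_simp
      _ ≤ (2 * P₁ * Q₁ * (Rα * Rβ) / (a * b)) * s := mul_le_mul_of_nonneg_left hdep (by positivity)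
      _ = 2 * P₁ * Q₁ * (Rα * Rβ) / s := by rw [hab]; field_simp
  have t4 : 2 * P₁ ^ 2 * d ^ 2 / (a * w₀ ^ 2) ≤ 2 * P₁ ^ 2 * Rα ^ 2 / a := by
    have : d ^ 2 ≤ (Rα * w₀) ^ 2 := pow_le_pow_left₀ hd0 hd 2
    calc 2 * P₁ ^ 2 * d ^ 2 / (a * w₀ ^ 2) ≤ 2 * P₁ ^ 2 * (Rα * w₀) ^ 2 / (a * w₀ ^ 2) := by gcongr
      _ = 2 * P₁ ^ 2 * Rα ^ 2 / a := by field_simp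
  linarith

end Coefficients

/-! ### The kernel bound -/

set_option maxHeartbeats 400000 in
-- six position cases in one statement; the scalar work is in `deepBarrier_coeff_*`
/-- **Two-point kernel bound across a single deep barrier, no sign condition on the fluxes.** Let
`u, v` solve `y″ = −φ y` on `ℝ` with constant fluxes `Im(ū u′) ≡ −σ`, `Im(v̄ v′) ≡ ω`, `σ, ω ≠ 0`; let
`φ` be continuous and `≤ 0` on `[α, β]`; let `‖u s‖ ≤ P_u` (`s ≤ α`), `‖v s‖ ≤ P_v` (`s ≥ β`),
`‖u′ α‖ ≤ P₁`, `‖v′ β‖ ≤ Q₁`; and suppose that EVERY monotone two-end real basis `g, d` of `y″ = −φ y`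
on `[α, β]` (`w₀ = g′(β)`) satisfies the depth `2P₁²Q₁² ≤ |σ||ω|w₀²` and the rate bounds
`d α ≤ R_α w₀`, `g β ≤ R_β w₀`, `g x·d x ≤ R_m w₀` for `x ∈ [α, β]` with `x₀ ≤ x` (`R_α, R_β, R_m ≥ 0`).
Then for all `x ≤ x′` with `x₀ ≤ x′`: `‖u x‖‖v x′‖ ≤ K·‖u x·v′ x − v x·u′ x‖` with
`K = 3P_u²/|σ| + 3P_v²/|ω| + 2P_uP_v/s + P_u(2Q₁R_β/s + 2P₁R_α/|σ|) + P_v(2Q₁R_β/|ω| + 2P₁R_α/s)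
 + (2Q₁²R_β²/|ω| + 2R_m + 2P₁Q₁R_αR_β/s + 2P₁²R_α²/|σ|)`, `s = √(|ω||σ|)`. [folklore] -/
theorem kernel_le_of_deep_barrier {u u' v v' : ℝ → ℂ} {φ : ℝ → ℝ} {σ ω : ℝ}
    (hu : ∀ x, HasDerivAt u (u' x) x ∧ HasDerivAt u' (-((φ x : ℂ) * u x)) x)
    (hv : ∀ x, HasDerivAt v (v' x) x ∧ HasDerivAt v' (-((φ x : ℂ) * v x)) x)
    (hfu : ∀ s, (conj (u s) * u' s).im = -σ) (hfv : ∀ s, (conj (v s) * v' s).im = ω)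
    (hσ : σ ≠ 0) (hω : ω ≠ 0) {α β : ℝ} (hαβ : α ≤ β) (hφc : Continuous φ)
    (hφ : ∀ s ∈ Icc α β, φ s ≤ 0) {Pu Pv P₁ Q₁ : ℝ}
    (hPu : ∀ s, s ≤ α → ‖u s‖ ≤ Pu) (hPv : ∀ s, β ≤ s → ‖v s‖ ≤ Pv)
    (hP₁ : ‖u' α‖ ≤ P₁) (hQ₁ : ‖v' β‖ ≤ Q₁)
    {x₀ Rα Rβ Rm : ℝ} (hRα : 0 ≤ Rα) (hRβ : 0 ≤ Rβ) (hRm : 0 ≤ Rm)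
    (hbasis : ∀ g g' d d' : ℝ → ℝ, ∀ w₀ : ℝ,
      (∀ x ∈ Icc α β, HasDerivAt g (g' x) x ∧ HasDerivAt g' (-φ x * g x) x) →
      (∀ x ∈ Icc α β, HasDerivAt d (d' x) x ∧ HasDerivAt d' (-φ x * d x) x) →
      g α = 1 → g' α = 0 → d β = 1 → d' β = 0 → g' β = w₀ →
      (∀ x ∈ Icc α β, 1 ≤ g x ∧ 0 ≤ g' x ∧ 1 ≤ d x ∧ d' x ≤ 0) →
      MonotoneOn g (Icc α β) → AntitoneOn d (Icc α β) →
      (∀ x ∈ Icc α β, g x * d' x - g' x * d x = -w₀) →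
        2 * P₁ ^ 2 * Q₁ ^ 2 ≤ |σ| * |ω| * w₀ ^ 2 ∧ d α ≤ Rα * w₀ ∧ g β ≤ Rβ * w₀ ∧
          ∀ x ∈ Icc α β, x₀ ≤ x → g x * d x ≤ Rm * w₀)
    {x x' : ℝ} (hxx' : x ≤ x') (hx₀ : x₀ ≤ x') :
    ‖u x‖ * ‖v x'‖ ≤
      (3 * Pu ^ 2 / |σ| + 3 * Pv ^ 2 / |ω| + 2 * Pu * Pv / Real.sqrt (|ω| * |σ|) +
        Pu * (2 * Q₁ * Rβ / Real.sqrt (|ω| * |σ|) + 2 * P₁ * Rα / |σ|) +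
        Pv * (2 * Q₁ * Rβ / |ω| + 2 * P₁ * Rα / Real.sqrt (|ω| * |σ|)) +
        (2 * Q₁ ^ 2 * Rβ ^ 2 / |ω| + 2 * Rm + 2 * P₁ * Q₁ * (Rα * Rβ) / Real.sqrt (|ω| * |σ|) +
          2 * P₁ ^ 2 * Rα ^ 2 / |σ|)) * ‖u x * v' x - v x * u' x‖ := by
  have hσ' : 0 < |σ| := abs_pos.2 hσ
  have hω' : 0 < |ω| := abs_pos.2 hω
  set s := Real.sqrt (|ω| * |σ|) with hs
  have hs1 : 0 < s := Real.sqrt_pos.2 (mul_pos hω' hσ')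
  have hs2 : s ^ 2 = |ω| * |σ| := Real.sq_sqrt (mul_pos hω' hσ').le
  have hα : α ∈ Icc α β := left_mem_Icc.2 hαβ
  have hβ : β ∈ Icc α β := right_mem_Icc.2 hαβ
  have hPu0 : 0 ≤ Pu := (norm_nonneg _).trans (hPu α le_rfl)
  have hPv0 : 0 ≤ Pv := (norm_nonneg _).trans (hPv β le_rfl)
  -- the Wronskian is a constant `Wc`
  set Wc := u x * v' x - v x * u' x with hWc
  have hWs : ∀ t, u t * v' t - v t * u' t = Wc := fun t ↦ wronskian_eq_of_global hu hv t x
  set W := ‖Wc‖ with hWdef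
  have hW0 : 0 ≤ W := norm_nonneg _
  -- `P₁, Q₁ > 0` (the fluxes are non-zero)
  have hP₁0 : 0 < P₁ := by
    have hne : u' α ≠ 0 := by
      intro e; have := hfu α; rw [e, mul_zero, Complex.zero_im] at this
      exact hσ (by linarith)
    exact (norm_pos_iff.2 hne).trans_le hP₁
  have hQ₁0 : 0 < Q₁ := by
    have hne : v' β ≠ 0 := by
      intro e; have := hfv β; rw [e, mul_zero, Complex.zero_im] at this; exact hω this.symm
    exact (norm_pos_iff.2 hne).trans_le hQ₁
  -- the barrier basis of `y″ = −φ y` on `[α, β]`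
  have hqc : Continuous fun t ↦ -φ t := hφc.neg
  have hq0 : ∀ t ∈ Icc α β, 0 ≤ (fun t ↦ -φ t) t := fun t ht ↦ by
    simp only [neg_nonneg]; exact hφ t ht
  obtain ⟨g, g', d, d', hgg, hdd, hgα, hg'α, hdβ, hd'β, hsign, hgm, hdm, hWgd, -, -⟩ :=
    exists_barrierBasis hqc hαβ hq0
  set w₀ := g' β with hw₀def
  have hg : ∀ t ∈ Icc α β, HasDerivAt g (g' t) t ∧ HasDerivAt g' ((fun t ↦ -φ t) t * g t) t :=
    fun t _ ↦ hgg t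
  have hd : ∀ t ∈ Icc α β, HasDerivAt d (d' t) t ∧ HasDerivAt d' ((fun t ↦ -φ t) t * d t) t :=
    fun t _ ↦ hdd t
  obtain ⟨hdeep, hdα, hgβ, hgd⟩ := hbasis g g' d d' w₀ hg hd hgα hg'α hdβ hd'β rfl hsign hgm hdm hWgd
  -- `w₀ > 0`
  have hw₀ : 0 < w₀ := by
    have h1 : 0 ≤ w₀ := (hsign β hβ).2.1
    rcases h1.eq_or_lt with h | h
    · exfalso
      rw [← h] at hdeep
      have : 0 < 2 * P₁ ^ 2 * Q₁ ^ 2 := by positivity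
      nlinarith
    · exact h
  -- the solutions on `[α, β]` in the `q = −φ` form, and their end fluxes
  have huI := sol_Icc_of_global hu α β
  have hvI := sol_Icc_of_global hv α β
  have hFu : (conj (u α) * u' α).im = -σ := hfu α
  have hFv : (conj (v β) * v' β).im = ω := hfv β
  have hσ0 : -σ ≠ 0 := neg_ne_zero.2 hσ
  have hdeep' : 2 * P₁ ^ 2 * Q₁ ^ 2 ≤ |(-σ)| * |ω| * w₀ ^ 2 := by rwa [abs_neg]
  -- dominance: the Wronskian floor, and the two-point bounds over the basis
  obtain ⟨-, -, hWx⟩ := barrier_dominance hαβ hw₀ hg hd hgα hg'α hdβ hd'β rfl hsign hgm hdm hWgd huI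
    hvI _ _ _ _ rfl rfl rfl rfl hFu hFv hσ0 hω hP₁ hQ₁ hdeep'
  obtain ⟨hB1, hB2, hB3, hB4⟩ := barrier_two_point_of_dominance hαβ hw₀ hg hd hgα hg'α hdβ hd'β rfl
    hsign hgm hdm hWgd huI hvI hFu hFv hσ0 hω hP₁ hQ₁ hdeep'
  rw [abs_neg] at hWx hB1 hB2 hB3 hB4
  have hfloor : |σ| * |ω| * w₀ / (2 * P₁ * Q₁) ≤ W := by
    have := (hWx α hα).2; rwa [hWs α] at this
  rw [hWs α] at hB1 hB2 hB3 hB4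
  -- scalar consequences of depth
  have hdep1 : P₁ * Q₁ / w₀ ≤ s := mul_div_le_sqrt_of_depth hw₀ hdeep
  have hthree : 1 + s / (|σ| * |ω| * w₀ / (2 * P₁ * Q₁)) ≤ 3 :=
    one_add_sqrt_div_floor_le_three hw₀ hP₁0 hQ₁0 hσ hω hdep1
  have hW₀pos : 0 < |σ| * |ω| * w₀ / (2 * P₁ * Q₁) :=
    div_pos (mul_pos (mul_pos hσ' hω') hw₀) (by positivity)
  -- the six case constants
  set c1 := 3 * Pu ^ 2 / |σ| with hc1
  set c6 := 3 * Pv ^ 2 / |ω| with hc6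
  set c3 := 2 * Pu * Pv / s with hc3
  set c2 := Pu * (2 * Q₁ * Rβ / s + 2 * P₁ * Rα / |σ|) with hc2
  set c5 := Pv * (2 * Q₁ * Rβ / |ω| + 2 * P₁ * Rα / s) with hc5
  set c4 := 2 * Q₁ ^ 2 * Rβ ^ 2 / |ω| + 2 * Rm + 2 * P₁ * Q₁ * (Rα * Rβ) / s +
    2 * P₁ ^ 2 * Rα ^ 2 / |σ| with hc4
  have hc1n : 0 ≤ c1 := by positivity
  have hc6n : 0 ≤ c6 := by positivity
  have hc3n : 0 ≤ c3 := by positivity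
  have hc2n : 0 ≤ c2 := by positivity
  have hc5n : 0 ≤ c5 := by positivity
  have hc4n : 0 ≤ c4 := by positivity
  -- it suffices to bound by one of the case constants
  suffices hcase : ‖u x‖ * ‖v x'‖ ≤ c1 * W ∨ ‖u x‖ * ‖v x'‖ ≤ c6 * W ∨ ‖u x‖ * ‖v x'‖ ≤ c3 * W ∨
      ‖u x‖ * ‖v x'‖ ≤ c2 * W ∨ ‖u x‖ * ‖v x'‖ ≤ c5 * W ∨ ‖u x‖ * ‖v x'‖ ≤ c4 * W by
    have htot : ∀ c, c ≤ c1 + c6 + c3 + c2 + c5 + c4 → ‖u x‖ * ‖v x'‖ ≤ c * W →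
        ‖u x‖ * ‖v x'‖ ≤ (c1 + c6 + c3 + c2 + c5 + c4) * W := fun c hc h ↦
      h.trans (mul_le_mul_of_nonneg_right hc hW0)
    rcases hcase with h | h | h | h | h | h
    · exact htot c1 (by linarith) h
    · exact htot c6 (by linarith) h
    · exact htot c3 (by linarith) h
    · exact htot c2 (by linarith) h
    · exact htot c5 (by linarith) h
    · exact htot c4 (by linarith) h
  rcases le_or_gt x' α with h1 | h1
  · -- case 1: `x ≤ x' ≤ α` (both points before the barrier)
    left
    have key := kernel_le_of_envelope_left_of_floor (hfu x') (hfv x') hσ (hPu x (hxx'.trans h1))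
      (hPu x' h1) hW₀pos (by rw [hWs x']; exact hfloor)
    rw [hWs x'] at key
    calc ‖u x‖ * ‖v x'‖ ≤ Pu ^ 2 / |σ| * (1 + s / (|σ| * |ω| * w₀ / (2 * P₁ * Q₁))) * W := key
      _ ≤ Pu ^ 2 / |σ| * 3 * W := by gcongr
      _ = c1 * W := by rw [hc1]; ring
  rcases le_or_gt x' β with h2 | h2
  · have hx'I : x' ∈ Icc α β := ⟨h1.le, h2⟩
    have hgx' : g x' ≤ Rβ * w₀ := (hgm hx'I hβ h2).trans hgβ
    rcases le_or_gt x α with h3 | h3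
    · -- case 2: `x ≤ α < x' ≤ β`
      right; right; right; left
      have hdx' : d x' ≤ Rα * w₀ := (hdm hα hx'I h1.le).trans hdα
      have hcoef := deepBarrier_coeff_left hσ' hω' hs1 hs2 hw₀ hP₁0.le hQ₁0.le hRβ hdep1 hgx' hdx'
      calc ‖u x‖ * ‖v x'‖ ≤ Pu * (W * (2 * P₁ * Q₁ ^ 2 * g x' / (|σ| * |ω| * w₀ ^ 2) +
            2 * P₁ * d x' / (|σ| * w₀))) := mul_le_mul (hPu x h3) (hB2 x' hx'I) (norm_nonneg _) hPu0
        _ ≤ Pu * (W * (2 * Q₁ * Rβ / s + 2 * P₁ * Rα / |σ|)) := by gcongr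
        _ = c2 * W := by rw [hc2]; ring
    · -- case 4: `α < x ≤ x' ≤ β` (both points inside)
      right; right; right; right; right
      have hxI : x ∈ Icc α β := ⟨h3.le, hxx'.trans h2⟩
      have hg0 : 0 ≤ g x' := by linarith [(hsign x' hx'I).1]
      have hdx : d x ≤ Rα * w₀ := (hdm hα hxI h3.le).trans hdα
      have hd0 : 0 ≤ d x := by linarith [(hsign x hxI).2.2.1]
      have hgβ0 : 0 ≤ g β := by linarith [(hsign β hβ).1]
      have hcoef := deepBarrier_coeff_inside hσ' hω' hs1 hs2 hw₀ hP₁0.le hQ₁0.le hRα hRβ hdep1 hg0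
        hgx' hd0 hdx (hgd x' hx'I hx₀) hdα hgβ0 hgβ
      calc ‖u x‖ * ‖v x'‖ ≤ _ := hB1 x hxI x' hx'I hxx'
        _ ≤ W * c4 := mul_le_mul_of_nonneg_left hcoef hW0
        _ = c4 * W := mul_comm _ _
  rcases le_or_gt x α with h3 | h3
  · -- case 3: `x ≤ α`, `β < x'` (straddling)
    right; right; left
    have hprod : ‖u x‖ * ‖v x'‖ ≤ Pu * Pv :=
      mul_le_mul (hPu x h3) (hPv x' h2.le) (norm_nonneg _) hPu0
    have hcoef : W * (2 * P₁ * Q₁ / (|σ| * |ω| * w₀)) ≤ W * (2 / s) :=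
      mul_le_mul_of_nonneg_left (deepBarrier_coeff_straddle hσ' hω' hs1 hs2 hw₀ hdep1) hW0
    calc ‖u x‖ * ‖v x'‖ ≤ Pu * Pv * 1 := by rw [mul_one]; exact hprod
      _ ≤ Pu * Pv * (W * (2 / s)) :=
          mul_le_mul_of_nonneg_left (hB4.trans hcoef) (mul_nonneg hPu0 hPv0)
      _ = c3 * W := by rw [hc3]; ring
  rcases le_or_gt x β with h4 | h4
  · -- case 5: `α < x ≤ β < x'`
    right; right; right; right; left
    have hxI : x ∈ Icc α β := ⟨h3.le, h4⟩
    have hgx : g x ≤ Rβ * w₀ := (hgm hxI hβ h4).trans hgβ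
    have hdx : d x ≤ Rα * w₀ := (hdm hα hxI h3.le).trans hdα
    have hg0 : 0 ≤ g x := by linarith [(hsign x hxI).1]
    have hd0 : 0 ≤ d x := by linarith [(hsign x hxI).2.2.1]
    have hcoef := deepBarrier_coeff_right hσ' hω' hs1 hs2 hw₀ hP₁0.le hQ₁0.le hRα hdep1 hgx hdx
    have hnn : 0 ≤ W * (2 * Q₁ * g x / (|ω| * w₀) + 2 * P₁ ^ 2 * Q₁ * d x / (|σ| * |ω| * w₀ ^ 2)) := by
      positivity
    calc ‖u x‖ * ‖v x'‖ ≤ (W * (2 * Q₁ * g x / (|ω| * w₀) +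
          2 * P₁ ^ 2 * Q₁ * d x / (|σ| * |ω| * w₀ ^ 2))) * Pv :=
          mul_le_mul (hB3 x hxI) (hPv x' h2.le) (norm_nonneg _) hnn
      _ ≤ (W * (2 * Q₁ * Rβ / |ω| + 2 * P₁ * Rα / s)) * Pv := by gcongr
      _ = c5 * W := by rw [hc5]; ring
  · -- case 6: `β < x ≤ x'` (both points after the barrier)
    right; left
    have key := kernel_le_of_envelope_right_of_floor (hfu x) (hfv x) hω (hPv x h4.le)
      (hPv x' (h4.le.trans hxx')) hW₀pos (by rw [hWs x]; exact hfloor)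
    calc ‖u x‖ * ‖v x'‖ ≤ Pv ^ 2 / |ω| * (1 + s / (|σ| * |ω| * w₀ / (2 * P₁ * Q₁))) * W := key
      _ ≤ Pv ^ 2 / |ω| * 3 * W := by gcongr
      _ = c6 * W := by rw [hc6]; ring

end Literature.Analysis.ODE

end
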